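import Literature.MathematicalPhysics.QuantumFieldTheory.Balaban1983to89.B12NodeKnitRecord13SepCoPH

/-!
# BalabanUVNodes ∕ N09 at the STAGE-13 v1.7 `SepCoPH` record — the NESTING binder (F7b) of the Theorem-3 member REDUCED to the SUPPORT binder
# (F7a) and ONE selection clause: «at the background the (2.9) fluctuation field vanishes» ([Balaban1987RG1] (2.1)–(2.3) p. 265, (2.9) p. 266)

TRACK A (YM-PLAN §2b, node N09 of 28 = [B12] = [Balaban1987RG1] (CMP 109) Thm 3 p. 264 + Lemma 4 p. 280), WIDTH SEAT `pub-ymgap-dag-n09-w3` (g0; HUMAN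
RULING D-0149, director-ym №197; plan g77 W-SEAT-START-LIST §n09 item 3).  Key of record it serves: K1⁷ `StabilityBAtRecordR13SepCoPH` = stmt-QuantumFields-20542
(`--supports`, count-neutral helper).  A NEW importing module (imports dag-n24-c g8's junction `B12NodeKnitRecord13SepCoPH` only); THEOREMS ONLY, def-free,
sorry-free, standard axioms.

WHY.  dag-n24-c's junction (`B12NodeKnitRecord13SepCoPH`, p572963 ∕ v1.1 p578606) supplies N24's displayed binder `h09T : ∀ P, smallCouplings → smallFieldInductive`
at any world bound to `(datumOfRecord₁₃SepCoPH θ h).C` from LOCATED inputs, among them two binders valued in K0e's maximal regular sets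
`regSetOfRecord K i ρ_i` (`ρ_i = betaInputOfRecord (TβOfRecord₁₃) (chiβOfRecord₁₃ θ) K g i`): (F7a) `hχreg` — SUPPORT «`χ^{(2.9)}_{i+1}(U) = 0` unless
`U ∈ regSetOfRecord K i ρ_i`» — and (F7b) `hnestreg` — NESTING «`Ū^{i+1}(U_k V) ∈ regSetOfRecord K i ρ_i` for `V ∈ domAlt_k`, `i + 1 < k ≤ K`» (17H's `h09supp` ∕
`h09nest`).  THIS FILE shows (F7b) is NOT an independent regular-set binder: it FOLLOWS from (F7a) and the identity PRINT HAS AT THE BACKGROUND — on the fibre over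
`W = Ū^{j+1}(U_k V)` the critical configuration (2.3) `V^{(j)}(W) = M^j(U_{j+1}(W))` IS `M^j(U_k V)` (the axial-gauge minimiser is HEREDITARY: `U_{j+1}(Ū^{j+1}(U_k V)) =
U_k V` by [B11] Thm 1 (9)–(10) + the uniqueness clause of (1.1) + the complete axial fixing of the residual group), so the fluctuation variable `V′ = V·V^{(j)⁻¹}`
of (2.1) is `1` there, `B′ = 0`, and every factor of (2.9) reads `χ(0 < ε₁) = 1`: `χ^{(2.9)}_j(Ū^j(U_k V)) = 1` (N29).  With (F7a) at step `i` (contrapositive: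
`χ^{(2.9)}_{i+1}(U) ≠ 0 ⇒ U ∈ regSetOfRecord K i ρ_i`) this gives (F7b).  So N09's located input list at Stage 13 loses one regular-set binder: (F7b) ↦ ONE SELECTION
CLAUSE on K0e's `critCfgOfRecord` — «HERED»: `critCfgOfRecord θ.ν K j (Ū^{j+1}(U_k V)) = Ū^j(U_k V)` (`V ∈ domAltOfRecord θ.ν K k`, `j < k ≤ K`) — and the numeric
sign `0 < θ.ε₂₉` (a conjunct of `Stage13Params.Admissible`; 17H's own `hε'`); (F7a) becomes the ONLY binder of N09 that mentions a maximal regular set.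

LOCATED TYPING NOTE (same species as dag-n24-c's (M1) note and dag-n09-w2's item 2, recorded, not a defect of print): HERED is print's property of the
axial-gauge selection `W ↦ U_{k+1}(W)`; it is NOT derivable for the record's bare-choice `Node00.Uk = dite (UkExists …) Classical.choose 1` (an opaque point of the
minimal orbit per `W`), exactly as (M1); it becomes a theorem the day the selection of record is hereditary (def-R ∕ K0c (H-U) species).  DISPLAYED, never
asserted.  A6: no inhabitant of HERED at the record is claimed here — the filing is LOCATED; the reductions are hypothesis-generic (`dom`, `ε` arbitrary in §2).

WHAT THIS FILE PROVES (10 theorems).  §1 at K0e's objects: `chiFix29AllOfRecord_eq_one_of_critCfg_eq`, `chiFix29OfRecord_eq_one_of_critCfg_eq` (`V^{(j)}(V̄) = V`,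
`0 < ε₁` ⇒ `χ^{(2.9)}_j(V) = 1`).  §2 at the ₁₃ record: `chiβ13_iter_eq_one_of_critCfg_eq`, `chiβ13_iterUk_eq_one_of_critCfg_hered` ((N29) from HERED),
`iterUk_mem_regSet_of_supp_of_chiβ13_eq_one` ((F7b) ⇐ (F7a) + (N29)), `iterUk_mem_regSet_of_supp_of_critCfg_hered` ((F7b) ⇐ (F7a) + HERED + `0 < ε₂₉`).
§3 N09 with `hnestreg` GONE: `thm3Member_stage13SepCoPH_of_regSets_of_critCfg_hered`, `b12_main_stage13SepCoPH_of_leaf_of_regSets_of_critCfg_hered`,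
`thm3Member_forall_stage13SepCoPH_of_regSets_of_critCfg_hered` (the `∀ P` form = N24's `h09T` ∕ 17H's `h09nest` supplier shape),
`thm3Member_forall_stage13SepCoPH_of_regSets_of_measurableUk_of_critCfg_hered` ((I19) ↦ (H-U) twin).

HONEST FRAMING: count-neutral kernel bookkeeping BY NAME (dag-n24-c's junction, K0e's `critCfgOfRecord` ∕ `chiFix29OfRecord` faces, the group axiom `dist1 1 = 0`);
NO estimate of Bałaban's is proved; (F7a), (M1), (I19)∕(H-U), [B11] Thm 1's three binders and HERED are DISPLAYED hypotheses, located in print, none asserted;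
N09 NOT discharged; conjunct 1 (Lemma 4, the leaf `b12`) untouched; K0⁷ ∕ K1⁷ NOT closed; counts unmoved (typed 28∕28 · discharged 5∕27); one finite four-torus
programme at fixed `ε = L^{−K}` per run — R4 closes the conditional rung `BalabanLadder.UV` only; NOT ℝ⁴, NOT infinite volume, NOT OS, NOT a mass gap, NOT Clay.
-/

noncomputable section

namespace Summit.QuantumFields.YangMills.BalabanUVNodes.N09AtRecord13SepCoPHFluctNesting

open MeasureTheory Set
open Literature.MathematicalPhysics.QuantumFieldTheory.Balaban1983to89
open Literature.MathematicalPhysics.QuantumFieldTheory.Balaban1983to89.T4Continuum (T4Family)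
open Literature.MathematicalPhysics.QuantumFieldTheory.Balaban1983to89.DagBinding (WorldP leavesP)
open Literature.MathematicalPhysics.QuantumFieldTheory.Balaban1983to89.Node00
open Literature.MathematicalPhysics.QuantumFieldTheory.Balaban1983to89.B12RTGaugeInvariance254 (LiftInvariant)
open Literature.MathematicalPhysics.QuantumFieldTheory.Balaban1983to89.B12NodeKnitRecord8 (b12_main_of_leaf_of_thm3Member)
open Literature.MathematicalPhysics.QuantumFieldTheory.Balaban1983to89.B12NodeKnitRecord13SepCoPH
  (thm3Member_stage13SepCoPH_of_regSets integrable_betaInput_stage13_of_measurableUk)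

variable {F : T4Family} {N : ℕ} [NeZero N]

/-! ## §1. At K0e's objects: the (2.9) cut-offs read `1` at a field that IS the critical configuration over its own average -/

/-- **«AT THE BACKGROUND THE FLUCTUATION FIELD VANISHES», all-bonds form**: if the critical configuration (2.3) over the average `V̄` of a step-`j` field `V` IS
`V` itself (`V^{(j)}(V̄) = V`), then every fluctuation variable `|V^{(j)}(V̄)(b)⁻¹·V(b) − 1|` is `|1 − 1| = 0`, so for a positive threshold `ε₁` the all-bonds cut-off
`χ^{(2.9),all}_j(V) = 1` — print's «`V′ = V(V^{(k)})⁻¹`», `B′ = (1∕i) log V′ = 0` at the critical configuration. [cite: Balaban1987RG1, (2.1)–(2.3) p.265 and (2.9) p.266] -/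
theorem chiFix29AllOfRecord_eq_one_of_critCfg_eq (ν : Stage7Numerics) {ε₁ : ℝ} (hε : 0 < ε₁) (K j : ℕ) {V : GaugeField (F.P K) j (SU N)}
    (h : critCfgOfRecord F N ν K j ((avOfRecord F N K j).avg V) = V) : chiFix29AllOfRecord F N ν ε₁ K j V = 1 := by
  rw [chiFix29AllOfRecord_eq_one_iff]
  intro b
  rw [fluctDevOfRecord_apply, h, inv_mul_cancel, GaugeGroup.dist1_one]
  exact hε

/-- **«AT THE BACKGROUND THE FLUCTUATION FIELD VANISHES», printed form** ((2.9) with the distinguished bonds `b₀(c)` excluded): `V^{(j)}(V̄) = V` and `0 < ε₁` give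
`χ^{(2.9)}_j(V) = 1`. [cite: Balaban1987RG1, (2.1)–(2.3) p.265 and (2.9) p.266] -/
theorem chiFix29OfRecord_eq_one_of_critCfg_eq (ν : Stage7Numerics) {ε₁ : ℝ} (hε : 0 < ε₁) (K j : ℕ) {V : GaugeField (F.P K) j (SU N)}
    (h : critCfgOfRecord F N ν K j ((avOfRecord F N K j).avg V) = V) : chiFix29OfRecord F N ν ε₁ K j V = 1 := by
  rw [chiFix29OfRecord_eq_one_iff]
  intro b _
  rw [fluctDevOfRecord_apply, h, inv_mul_cancel, GaugeGroup.dist1_one]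
  exact hε

/-! ## §2. At the Stage-13 record: (N29) from the hereditary clause, and (F7b) from (F7a) + (N29) -/

/-- **(N29) AT ONE FIELD, Stage-13 β-slot cut-off** `chiβOfRecord₁₃ θ₀ = chiFixed29 θ₀.ν θ₀.ε₂₉` (coupling-blind): for a fine configuration `U₀` whose `j`-fold
average `M^j(U₀)` IS the critical configuration over its `(j+1)`-fold average — `V^{(j)}(M^{j+1}(U₀)) = M^j(U₀)` — and `0 < ε₂₉`: `χ^{(2.9)}_j(M^j(U₀)) = 1`
(`M(M^j U₀) = M^{j+1} U₀` is `rfl`). [cite: Balaban1987RG1, (2.3) p.265 and (2.9) p.266] -/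
theorem chiβ13_iter_eq_one_of_critCfg_eq (θ₀ : Stage13Params F N) (hε : 0 < θ₀.ε₂₉) (K : ℕ) (g : ℕ → ℝ) (j : ℕ)
    {U₀ : GaugeField (F.P K) 0 (SU N)}
    (h : critCfgOfRecord F N θ₀.ν K j (Averaging.iter (avOfRecord F N K) (j + 1) U₀) = Averaging.iter (avOfRecord F N K) j U₀) :
    chiβOfRecord₁₃ F N θ₀ K g j (Averaging.iter (avOfRecord F N K) j U₀) = 1 :=
  have h' : critCfgOfRecord F N θ₀.ν K j ((avOfRecord F N K j).avg (Averaging.iter (avOfRecord F N K) j U₀)) =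
      Averaging.iter (avOfRecord F N K) j U₀ := h
  chiFix29OfRecord_eq_one_of_critCfg_eq θ₀.ν hε K j h'

/-- **(N29) ALONG A RUN FROM THE HEREDITARY CLAUSE «HERED»**: if, for every `V` of the level-`k` domain `dom k` (`k ≤ K`) and every `j < k`, the critical configuration
over `Ū^{j+1}(U_k V)` is `Ū^j(U_k V)` — print: `V^{(j)}(M^{j+1}(U_k V)) = M^j(U_{j+1}(M^{j+1}(U_k V))) = M^j(U_k V)` because the axial-gauge minimiser RESTRICTS exactly,
`U_{j+1}(Ū^{j+1}(U_k V)) = U_k V` ([B11] Thm 1 (9)–(10), (1.1) uniqueness, axial fixing of the residual group) — and `0 < ε₂₉`, then the averaged backgrounds sit where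
the β-slot cut-off is `1`: `χ^{(2.9)}_j(Ū^j(U_k V)) = 1`.  HERED is DISPLAYED (NOT derivable for the bare-choice `Uk` of record); `dom`, `ε` arbitrary.
[cite: Balaban1987RG1, (2.3) p.265, (2.9) p.266 and (1.1)–(1.2) p.260; Balaban1985Variational, Thm 1 (9)–(10) p.279] -/
theorem chiβ13_iterUk_eq_one_of_critCfg_hered (θ₀ : Stage13Params F N) (hε : 0 < θ₀.ε₂₉) (P : B12.RunParams) {ε : ℝ}
    {dom : (k : ℕ) → Set (GaugeField (F.P P.K) k (SU N))}
    (hher : ∀ k, k ≤ P.K → ∀ V ∈ dom k, ∀ j < k,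
      critCfgOfRecord F N θ₀.ν P.K j (Averaging.iter (avOfRecord F N P.K) (j + 1) (Uk F N P.K k ε V)) =
        Averaging.iter (avOfRecord F N P.K) j (Uk F N P.K k ε V)) :
    ∀ k, k ≤ P.K → ∀ V ∈ dom k, ∀ j < k,
      chiβOfRecord₁₃ F N θ₀ P.K (gOfRecord₁₃ F N θ₀ P) j (Averaging.iter (avOfRecord F N P.K) j (Uk F N P.K k ε V)) = 1 :=
  fun k hk V hV j hj => chiβ13_iter_eq_one_of_critCfg_eq θ₀ hε P.K _ j (hher k hk V hV j hj)

/-- **(F7b) FROM (F7a) AND (N29)** — the NESTING binder of dag-n24-c's located form is a consequence of its SUPPORT binder: if (F7a) `χ^{(2.9)}_{i+1} = 0` off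
`regSetOfRecord K i ρ_i` (`i + 1 < K`; `ρ_i` the (0.19) density met over `TβOfRecord₁₃ = TcanOfRecord`), and (N29) the β-slot cut-off is `1` at every averaged
background `Ū^j(U_k V)` (`V ∈ dom k`, `j < k ≤ K`), then `Ū^{i+1}(U_k V) ∈ regSetOfRecord K i ρ_i` for `i + 1 < k` (contrapositive of (F7a): `1 ≠ 0`).  Pure logic;
`dom`, `ε` arbitrary. [cite: Balaban1987RG1, p.256 l.6, (2.1) p.265, (2.9)–(2.10) pp.266–267 and p.259 (bookkeeping)] -/
theorem iterUk_mem_regSet_of_supp_of_chiβ13_eq_one (θ₀ : Stage13Params F N) (P : B12.RunParams) {ε : ℝ}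
    {dom : (k : ℕ) → Set (GaugeField (F.P P.K) k (SU N))}
    (hχreg : ∀ i, i + 1 < P.K → ∀ U, U ∉ regSetOfRecord F N P.K i
        (betaInputOfRecord F N (TβOfRecord₁₃ F N) (chiβOfRecord₁₃ F N θ₀) P.K (gOfRecord₁₃ F N θ₀ P) i) →
      chiβOfRecord₁₃ F N θ₀ P.K (gOfRecord₁₃ F N θ₀ P) (i + 1) U = 0)
    (hone : ∀ k, k ≤ P.K → ∀ V ∈ dom k, ∀ j < k,
      chiβOfRecord₁₃ F N θ₀ P.K (gOfRecord₁₃ F N θ₀ P) j (Averaging.iter (avOfRecord F N P.K) j (Uk F N P.K k ε V)) = 1) :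
    ∀ k, k ≤ P.K → ∀ V ∈ dom k, ∀ i, i + 1 < k →
      Averaging.iter (avOfRecord F N P.K) (i + 1) (Uk F N P.K k ε V) ∈ regSetOfRecord F N P.K i
        (betaInputOfRecord F N (TβOfRecord₁₃ F N) (chiβOfRecord₁₃ F N θ₀) P.K (gOfRecord₁₃ F N θ₀ P) i) := by
  intro k hk V hV i hi
  by_contra hmem
  have h0 := hχreg i (lt_of_lt_of_le hi hk) _ hmem
  rw [hone k hk V hV (i + 1) hi] at h0
  exact one_ne_zero h0

/-- **(F7b) FROM (F7a), THE HEREDITARY CLAUSE AND `0 < ε₂₉`** — the two previous theorems composed: N09's nesting binder at the Stage-13 record is supplied by its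
support binder, the selection clause HERED on `critCfgOfRecord` (print's axial-gauge property; DISPLAYED, not derivable for the bare-choice `Uk`) and the sign of the
(2.9) threshold.  `dom`, `ε` arbitrary. [cite: Balaban1987RG1, (2.1)–(2.3) p.265, (2.9)–(2.10) pp.266–267 and (1.1)–(1.2) p.260; Balaban1985Variational, Thm 1 (9)–(10) p.279] -/
theorem iterUk_mem_regSet_of_supp_of_critCfg_hered (θ₀ : Stage13Params F N) (hε : 0 < θ₀.ε₂₉) (P : B12.RunParams) {ε : ℝ}
    {dom : (k : ℕ) → Set (GaugeField (F.P P.K) k (SU N))}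
    (hχreg : ∀ i, i + 1 < P.K → ∀ U, U ∉ regSetOfRecord F N P.K i
        (betaInputOfRecord F N (TβOfRecord₁₃ F N) (chiβOfRecord₁₃ F N θ₀) P.K (gOfRecord₁₃ F N θ₀ P) i) →
      chiβOfRecord₁₃ F N θ₀ P.K (gOfRecord₁₃ F N θ₀ P) (i + 1) U = 0)
    (hher : ∀ k, k ≤ P.K → ∀ V ∈ dom k, ∀ j < k,
      critCfgOfRecord F N θ₀.ν P.K j (Averaging.iter (avOfRecord F N P.K) (j + 1) (Uk F N P.K k ε V)) =
        Averaging.iter (avOfRecord F N P.K) j (Uk F N P.K k ε V)) :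
    ∀ k, k ≤ P.K → ∀ V ∈ dom k, ∀ i, i + 1 < k →
      Averaging.iter (avOfRecord F N P.K) (i + 1) (Uk F N P.K k ε V) ∈ regSetOfRecord F N P.K i
        (betaInputOfRecord F N (TβOfRecord₁₃ F N) (chiβOfRecord₁₃ F N θ₀) P.K (gOfRecord₁₃ F N θ₀ P) i) :=
  iterUk_mem_regSet_of_supp_of_chiβ13_eq_one θ₀ P hχreg (chiβ13_iterUk_eq_one_of_critCfg_hered θ₀ hε P hher)

/-! ## §3. The Theorem-3 member ∕ N09 at the Stage-13 v1.7 construction, located form, with the nesting binder REPLACED by HERED + `0 < ε₂₉` -/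

/-- **THE THEOREM-3 MEMBER AT THE STAGE-13 v1.7 CONSTRUCTION, LOCATED FORM, NESTING BINDER GONE**: dag-n24-c's `thm3Member_stage13SepCoPH_of_regSets` with `hnestreg`
supplied by `iterUk_mem_regSet_of_supp_of_critCfg_hered`.  Displayed, each located in print: (M1) `hχinv` lift-invariance of `χ^{(2.9)}` along the run; (F7a) `hχreg`
support inside the maximal regular set of the previous canonical-version transform (the ONLY regular-set binder left); (I19) `hint`; [B11] Thm 1's `h11 ∕ hres ∕
huniq` on `domAltOfRecord θ.ν`; HERED `hher` (selection clause, NOT derivable for the bare-choice `Uk`); the sign `0 < θ.ε₂₉`.  CONDITIONAL; nothing of Bałaban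
asserted; N09 NOT discharged. [cite: Balaban1987RG1, Thm 3 p.264, (1.1)–(1.3) p.260, (0.13) p.254, (2.1)–(2.3) p.265, (2.9)–(2.10) pp.266–267; Balaban1985Variational, Thm 1 (8)–(10) p.279] -/
theorem thm3Member_stage13SepCoPH_of_regSets_of_critCfg_hered (θ : Stage13HParams F N) (h : θ.Provisos₁₃SepCoPH F N) {w : WorldP}
    (hC : w.C = (datumOfRecord₁₃SepCoPH F N θ h).C) (P : B12.RunParams) (hε : 0 < θ.ε₂₉)
    (hχinv : ∀ j < P.K, LiftInvariant (chiβOfRecord₁₃ F N θ.toStage13Params P.K (gOfRecord₁₃ F N θ.toStage13Params P) j))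
    (hχreg : ∀ i, i + 1 < P.K → ∀ U, U ∉ regSetOfRecord F N P.K i
        (betaInputOfRecord F N (TβOfRecord₁₃ F N) (chiβOfRecord₁₃ F N θ.toStage13Params) P.K (gOfRecord₁₃ F N θ.toStage13Params P) i) →
      chiβOfRecord₁₃ F N θ.toStage13Params P.K (gOfRecord₁₃ F N θ.toStage13Params P) (i + 1) U = 0)
    (hint : ∀ j < P.K, Integrable (betaInputOfRecord F N (TβOfRecord₁₃ F N) (chiβOfRecord₁₃ F N θ.toStage13Params) P.K (gOfRecord₁₃ F N θ.toStage13Params P) j)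
      (fieldMeasure (F.P P.K) j (SU N)))
    (h11 : ∀ k, k ≤ P.K → ∀ V ∈ domAltOfRecord F N θ.ν P.K k, UkExists F N P.K k θ.εbg V ∧ UniqueUkOrbit F N P.K k θ.εbg V)
    (hres : ∀ k, k ≤ P.K → HRestrict F N θ.εbg P.K k (domAltOfRecord F N θ.ν P.K k))
    (huniq : ∀ k, k ≤ P.K → ∀ V ∈ domAltOfRecord F N θ.ν P.K k, ∀ j < k,
      UniqueUkOrbit F N P.K (j + 1) θ.εbg (Averaging.iter (avOfRecord F N P.K) (j + 1) (Uk F N P.K k θ.εbg V)))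
    (hher : ∀ k, k ≤ P.K → ∀ V ∈ domAltOfRecord F N θ.ν P.K k, ∀ j < k,
      critCfgOfRecord F N θ.ν P.K j (Averaging.iter (avOfRecord F N P.K) (j + 1) (Uk F N P.K k θ.εbg V)) =
        Averaging.iter (avOfRecord F N P.K) j (Uk F N P.K k θ.εbg V)) :
    (leavesP w P).smallCouplings → (leavesP w P).smallFieldInductive :=
  thm3Member_stage13SepCoPH_of_regSets θ h hC P hχinv hχreg hint h11 hres huniq
    (iterUk_mem_regSet_of_supp_of_critCfg_hered θ.toStage13Params hε P hχreg hher)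

/-- **N09 AT `(w, P)`, Stage-13 v1.7 construction, LOCATED FORM, NESTING BINDER GONE**: own leaf `b12` + the inputs above ⇒ `Dag.B12_main (leavesP w P)`.
CONDITIONAL; N09 NOT discharged. [cite: Balaban1987RG1, Lemma 4 (3.53) p.280, Thm 3 p.264, (2.1)–(2.3) p.265 and (2.9) p.266; Balaban1985Variational, Thm 1 p.279] -/
theorem b12_main_stage13SepCoPH_of_leaf_of_regSets_of_critCfg_hered (θ : Stage13HParams F N) (h : θ.Provisos₁₃SepCoPH F N) {w : WorldP}
    (hC : w.C = (datumOfRecord₁₃SepCoPH F N θ h).C) (P : B12.RunParams) (h12 : (leavesP w P).b12) (hε : 0 < θ.ε₂₉)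
    (hχinv : ∀ j < P.K, LiftInvariant (chiβOfRecord₁₃ F N θ.toStage13Params P.K (gOfRecord₁₃ F N θ.toStage13Params P) j))
    (hχreg : ∀ i, i + 1 < P.K → ∀ U, U ∉ regSetOfRecord F N P.K i
        (betaInputOfRecord F N (TβOfRecord₁₃ F N) (chiβOfRecord₁₃ F N θ.toStage13Params) P.K (gOfRecord₁₃ F N θ.toStage13Params P) i) →
      chiβOfRecord₁₃ F N θ.toStage13Params P.K (gOfRecord₁₃ F N θ.toStage13Params P) (i + 1) U = 0)
    (hint : ∀ j < P.K, Integrable (betaInputOfRecord F N (TβOfRecord₁₃ F N) (chiβOfRecord₁₃ F N θ.toStage13Params) P.K (gOfRecord₁₃ F N θ.toStage13Params P) j)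
      (fieldMeasure (F.P P.K) j (SU N)))
    (h11 : ∀ k, k ≤ P.K → ∀ V ∈ domAltOfRecord F N θ.ν P.K k, UkExists F N P.K k θ.εbg V ∧ UniqueUkOrbit F N P.K k θ.εbg V)
    (hres : ∀ k, k ≤ P.K → HRestrict F N θ.εbg P.K k (domAltOfRecord F N θ.ν P.K k))
    (huniq : ∀ k, k ≤ P.K → ∀ V ∈ domAltOfRecord F N θ.ν P.K k, ∀ j < k,
      UniqueUkOrbit F N P.K (j + 1) θ.εbg (Averaging.iter (avOfRecord F N P.K) (j + 1) (Uk F N P.K k θ.εbg V)))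
    (hher : ∀ k, k ≤ P.K → ∀ V ∈ domAltOfRecord F N θ.ν P.K k, ∀ j < k,
      critCfgOfRecord F N θ.ν P.K j (Averaging.iter (avOfRecord F N P.K) (j + 1) (Uk F N P.K k θ.εbg V)) =
        Averaging.iter (avOfRecord F N P.K) j (Uk F N P.K k θ.εbg V)) :
    Dag.B12_main (leavesP w P) :=
  b12_main_of_leaf_of_thm3Member h12
    (thm3Member_stage13SepCoPH_of_regSets_of_critCfg_hered θ h hC P hε hχinv hχreg hint h11 hres huniq hher)

/-- **THE `∀ P` FORM = N24's DISPLAYED BINDER `h09T` AT A WORLD BOUND TO THE STAGE-13 v1.7 CONSTRUCTION, NESTING BINDER GONE** (the shape 17H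
`…SignFreeN09Located` consumes run by run; its `h09nest` is now supplied from its `h09supp` + HERED + its `hε'`).  CONDITIONAL; N09 NOT discharged; K1⁷ NOT closed.
[cite: Balaban1987RG1, Thm 3 p.264, (1.1)–(1.3) p.260, (2.1)–(2.3) p.265, (2.9)–(2.10) pp.266–267; Balaban1985Variational, Thm 1 (8)–(10) p.279] -/
theorem thm3Member_forall_stage13SepCoPH_of_regSets_of_critCfg_hered (θ : Stage13HParams F N) (h : θ.Provisos₁₃SepCoPH F N) {w : WorldP}
    (hC : w.C = (datumOfRecord₁₃SepCoPH F N θ h).C) (hε : 0 < θ.ε₂₉)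
    (hχinv : ∀ (P : B12.RunParams), ∀ j < P.K, LiftInvariant (chiβOfRecord₁₃ F N θ.toStage13Params P.K (gOfRecord₁₃ F N θ.toStage13Params P) j))
    (hχreg : ∀ (P : B12.RunParams) (i : ℕ), i + 1 < P.K → ∀ U, U ∉ regSetOfRecord F N P.K i
        (betaInputOfRecord F N (TβOfRecord₁₃ F N) (chiβOfRecord₁₃ F N θ.toStage13Params) P.K (gOfRecord₁₃ F N θ.toStage13Params P) i) →
      chiβOfRecord₁₃ F N θ.toStage13Params P.K (gOfRecord₁₃ F N θ.toStage13Params P) (i + 1) U = 0)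
    (hint : ∀ (P : B12.RunParams), ∀ j < P.K, Integrable (betaInputOfRecord F N (TβOfRecord₁₃ F N) (chiβOfRecord₁₃ F N θ.toStage13Params) P.K
      (gOfRecord₁₃ F N θ.toStage13Params P) j) (fieldMeasure (F.P P.K) j (SU N)))
    (h11 : ∀ (P : B12.RunParams) (k : ℕ), k ≤ P.K → ∀ V ∈ domAltOfRecord F N θ.ν P.K k, UkExists F N P.K k θ.εbg V ∧ UniqueUkOrbit F N P.K k θ.εbg V)
    (hres : ∀ (P : B12.RunParams) (k : ℕ), k ≤ P.K → HRestrict F N θ.εbg P.K k (domAltOfRecord F N θ.ν P.K k))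
    (huniq : ∀ (P : B12.RunParams) (k : ℕ), k ≤ P.K → ∀ V ∈ domAltOfRecord F N θ.ν P.K k, ∀ j < k,
      UniqueUkOrbit F N P.K (j + 1) θ.εbg (Averaging.iter (avOfRecord F N P.K) (j + 1) (Uk F N P.K k θ.εbg V)))
    (hher : ∀ (P : B12.RunParams) (k : ℕ), k ≤ P.K → ∀ V ∈ domAltOfRecord F N θ.ν P.K k, ∀ j < k,
      critCfgOfRecord F N θ.ν P.K j (Averaging.iter (avOfRecord F N P.K) (j + 1) (Uk F N P.K k θ.εbg V)) =
        Averaging.iter (avOfRecord F N P.K) j (Uk F N P.K k θ.εbg V)) :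
    ∀ P : B12.RunParams, (leavesP w P).smallCouplings → (leavesP w P).smallFieldInductive :=
  fun P => thm3Member_stage13SepCoPH_of_regSets_of_critCfg_hered θ h hC P hε (hχinv P) (hχreg P) (hint P) (h11 P) (hres P) (huniq P) (hher P)

/-- **THE `∀ P` FORM, (I19) REPLACED BY (H-U), NESTING BINDER GONE** — dag-n24-c v1.1's `…_of_regSets_of_measurableUk` shape: the integrability binder supplied by
`integrable_betaInput_stage13_of_measurableUk` from the MEASURABILITY of the minimiser selection `W ↦ U_{k+1}(W)` (`hU`).  So N09's located residue at Stage 13 reads: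
THREE properties of the selection of record — measurable (H-U), covariant (M1), hereditary (HERED) — plus ONE analytic clause (F7a), plus [B11] Thm 1 (N07).
CONDITIONAL; N09 NOT discharged; K1⁷ NOT closed. [cite: Balaban1987RG1, Thm 3 p.264, (0.19) p.255, (1.1)–(1.3) p.260, (2.1)–(2.3) p.265, (2.9)–(2.10) pp.266–267; Balaban1985Variational, Thm 1 (8)–(10) p.279] -/
theorem thm3Member_forall_stage13SepCoPH_of_regSets_of_measurableUk_of_critCfg_hered (θ : Stage13HParams F N) (h : θ.Provisos₁₃SepCoPH F N) {w : WorldP}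
    (hC : w.C = (datumOfRecord₁₃SepCoPH F N θ h).C) (hε : 0 < θ.ε₂₉)
    (hχinv : ∀ (P : B12.RunParams), ∀ j < P.K, LiftInvariant (chiβOfRecord₁₃ F N θ.toStage13Params P.K (gOfRecord₁₃ F N θ.toStage13Params P) j))
    (hU : ∀ (P : B12.RunParams) (k : ℕ), k < P.K → Measurable (Uk F N P.K (k + 1) θ.ν.εreg))
    (hχreg : ∀ (P : B12.RunParams) (i : ℕ), i + 1 < P.K → ∀ U, U ∉ regSetOfRecord F N P.K i
        (betaInputOfRecord F N (TβOfRecord₁₃ F N) (chiβOfRecord₁₃ F N θ.toStage13Params) P.K (gOfRecord₁₃ F N θ.toStage13Params P) i) →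
      chiβOfRecord₁₃ F N θ.toStage13Params P.K (gOfRecord₁₃ F N θ.toStage13Params P) (i + 1) U = 0)
    (h11 : ∀ (P : B12.RunParams) (k : ℕ), k ≤ P.K → ∀ V ∈ domAltOfRecord F N θ.ν P.K k, UkExists F N P.K k θ.εbg V ∧ UniqueUkOrbit F N P.K k θ.εbg V)
    (hres : ∀ (P : B12.RunParams) (k : ℕ), k ≤ P.K → HRestrict F N θ.εbg P.K k (domAltOfRecord F N θ.ν P.K k))
    (huniq : ∀ (P : B12.RunParams) (k : ℕ), k ≤ P.K → ∀ V ∈ domAltOfRecord F N θ.ν P.K k, ∀ j < k,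
      UniqueUkOrbit F N P.K (j + 1) θ.εbg (Averaging.iter (avOfRecord F N P.K) (j + 1) (Uk F N P.K k θ.εbg V)))
    (hher : ∀ (P : B12.RunParams) (k : ℕ), k ≤ P.K → ∀ V ∈ domAltOfRecord F N θ.ν P.K k, ∀ j < k,
      critCfgOfRecord F N θ.ν P.K j (Averaging.iter (avOfRecord F N P.K) (j + 1) (Uk F N P.K k θ.εbg V)) =
        Averaging.iter (avOfRecord F N P.K) j (Uk F N P.K k θ.εbg V)) :
    ∀ P : B12.RunParams, (leavesP w P).smallCouplings → (leavesP w P).smallFieldInductive :=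
  fun P => thm3Member_stage13SepCoPH_of_regSets_of_critCfg_hered θ h hC P hε (hχinv P) (hχreg P)
    (integrable_betaInput_stage13_of_measurableUk θ.toStage13Params P (hU P)) (h11 P) (hres P) (huniq P) (hher P)

end Summit.QuantumFields.YangMills.BalabanUVNodes.N09AtRecord13SepCoPHFluctNesting

end
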